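import Literature.Claims.NS.Chae2007
import Literature.Analysis.FluidPDE.CriticalSpaces
import Mathlib.Analysis.Distribution.Sobolev
import HarnessLib

/-!
# Claim skeleton C143 `Guevremont2026` — Barry Lee Guevremont, «Global Regularity of 3D Incompressible
# Navier-Stokes Equations via Deterministic Harmonic Resolution» (Zenodo record 21768533, concept 21768532;
# record created 2026-08-03, printed «V1.0» of «March 11, 2026»; 10 pp.)

Cell `ns-claims` (D-0090 NS-CLAIMS SWEEP), claim C143 (RULINGS v1.35 (1), tail tranche 2 row A5), typist
`ns-claims-typist-4` (g5); refuter of record `ns-claims-refuter-3` (g4), second `ns-claims-refuter-5`;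
referee lane 3; salvage `ns-claims-salvage-p1`. UNREFEREED / DISPUTED CLAIM under adjudication —
**nothing in this file asserts a step**: the claimed statement and every step are `Prop`-valued definitions;
the `theorem`s are (i) the kernel COMPOSITION of the paper's own chain (pure logic plus bookkeeping),
(ii) the Clay link, (iii) two finite computations about the D3Q13 lattice moments which the text prints and
which are true (`stepL1_holds`, `M4_xxxx`, `M4_xxyy`), and (iv) the Beale–Kato–Majda dichotomy on the
tree's `H^∞` sub-class (`step0_holds_onHInfty`) and a sufficient condition for the printed data class
(`inHs_of_hasCompactSupport`), both from the tree / Mathlib.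

TEXT OF RECORD: the census pin `pub/ns-claims/census/texts/Guevremont2026/zenodo-21768533.pdf` (README
sha16 2646e8bcaae1f39d) = `pub/ns-claims/sources/Guevremont2026/Guevremont2026_zenodo21768533.pdf`, PDF
sha16 a91d2508a8477ced, ONE version; PDF page = printed page; line numbers below are those of
`sources/Guevremont2026/pages/pNNN.txt` (ns-claims-lit-2 g5, LOCATORS.md sha16 3075472dab08a090). Bib key
`Guevremont2026` (doi 10.5281/zenodo.21768533).

## What the text contains (LOCATORS §1, checked on the pages)

There is NO numbered theorem environment in the 10 pages; the claimed statement is the ABSTRACT p.1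
l.7–15 (RULINGS v1.35 (1): typed as `ClaimedTheorem`, said so in its docstring). The only item called
«Lemma» is the unnumbered «Tension Tensor Lemma» §3.2 p.4 l.61–63, a statement about the D3Q13
lattice-Boltzmann model of §2. Printed chain (§8 p.8 l.2–7 summarises it): (1)–(2) on `ℝ³` (p.1 l.23–24)
→ D3Q13 lattice with weights `w₀ = 0`, `w_a = 1/12`, grid spacing `h`, «fixed temporal grain» `δ`,
`c = h/δ`, spectral cut-off `k_max = 1/(cδ)` (§2.1–2.3 p.3) → moment tensors `M_ij = (2/3)δ_ij`,
`M_ijkl = (1/3)(δδ + δδ + δδ)` «In particular, Mxxxx = 2/3 and Mxxyy = 1/3» (§2.2 p.3 l.9–40) →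
Chapman–Enskog recovery of (1)–(2) and the Tension Tensor Lemma (§3.1–3.2 p.4) → «strict energy equality …
on the resolved manifold» (§3.3 p.5 l.1–34) → cell enstrophy inequality with a quartic term
`−‖ω‖⁴_cell/δ` (§2.4 p.4 l.5–20 = §4.1 p.5 l.40–52, ASSERTED: «this appears as», «comes directly from the
13-node pivot redistribution») → «Integrating over space gives the global enstrophy inequality
dΩ/dt ≤ CΩ^{3/2} − (1/δ)Ω², where Ω(t) = ½∫|ω|² dx and δ > 0 is any fixed positive resolution
parameter» (p.5 l.52–66) → «sup_{t≥0} Ω(t) ≤ max(Ω(0), C²δ/4)» (§4.2 p.5 l.67–74) → «‖ω(t)‖_{L∞} ≤ …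
≤ C(δ)√Ω(t), where ‖ω‖_{H²} ≤ k_max‖ω‖_{H¹}» (§4.3 p.5 l.75–86) → BKM (§4.4 p.6 l.1–10) → the bridge
§6 p.6 l.27–45, p.7 l.1–5 («the classical continuum Navier-Stokes equations are recovered **only** as a
regular solution on the resolved manifold»; «globally regular precisely because the physical fluid cannot
access the singular continuum limit»). §7 p.7 l.6–40 «Formal Verification (Lean 4)» prints a 31-line
Lean-style listing whose mathematical glyphs are absent IN THE PDF and whose tactic blocks name nine
undeclared identifiers; the Zenodo record holds no `.lean` file — a printed pseudo-listing, recorded in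
CARD §1, NOT a step and not an artefact under adjudication.

## How it is typed

* The objects the text never defines — `δ`, `h`, the constant `C` of the enstrophy law, `C(δ)` of §4.3,
  and the cell functionals `‖ω‖²_cell`, `‖∇u‖_cell` — are packaged as parameters `R : Resolution` (pattern
  `N : Substrate` of C102 / `N : Notions` of C07): one choice of constants for all solutions, as printed
  («δ > 0 is any fixed positive resolution parameter», p.5 l.66; «The bound is time-independent», l.74).
  The lattice moment tensors ARE defined in print and are typed verbatim (`dir`, `M2`, `M4`,
  `Step_L1_M2`, `Step_L2_M4iso`) so that the Δ2 axis (lattice model vs. (1)–(2)) is visible in its own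
  declarations (REF ref-3 g5 10:07:57Z). The lattice BGK dynamics of §3.1, the Chapman–Enskog expansion,
  the «13-node pivot redistribution» and the spectral projection `P` act on objects (populations `f_a`,
  band-limited fields) for which neither the text nor the tree has a vocabulary at the grain of (1)–(2);
  they are not typed, and the Tension Tensor Lemma enters only through its printed ground, the isotropy
  display `Step_L2_M4iso`.
* The NS-grain steps (1, 3, 5) are typed ALONG SMOOTH SOLUTIONS OF (1)–(2) ON `ℝ³` from data of the
  printed class — the reading under which the abstract's claim about (1)–(2) follows from them (the
  composition `claim_of_steps` is a kernel theorem). Each docstring quotes the sentence that places the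
  display «on the lattice» / «on the resolved manifold»: whether the located step is read as a false
  assertion about (1)–(2) or as a statement about the lattice model (wrong problem, Δ2) is the refuter's
  and the chair's call, not the typist's.
* Data class AS PRINTED: «smooth, divergence-free … u₀ ∈ H^s(ℝ³) with s ≥ 1/2» — `IsDatum s u₀` with
  `H^s`-membership `InHs s u₀` stated through Mathlib's Bessel-potential Sobolev space
  (`TemperedDistribution.MemSobolev s 2`) of the tempered distribution of `u₀` (tree predicate
  `IsDistributionOf`). Every smooth compactly supported field is in the class for every `s`
  (`inHs_of_hasCompactSupport`, from Mathlib's `SchwartzMap.memSobolev`). Solutions: the tree's classical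
  (jointly `C^∞`) solutions `IsClassicalNSSolutionOn`, unforced, with `u(0) = u₀` — «smooth solution».
  «Unique» (p.1 l.11) is typed separately (`ClaimedUniqueness`) and not consumed.
* `Ω(t) = ½∫|ω|²` is the `toReal` of a lower Lebesgue integral (`ensE`, no junk value: the steps that
  display `Ω(t)` as a number state its finiteness, as in C102); `‖ω(t)‖_{L∞}` is `vortSup` in `[0,∞]`.

## Clay delta (reference `Literature.Claims.NS.ClayVariants`, axes of its §3; LOCATORS §2)

Direction REGULARITY (POS); nearest Clay statement (A) = `ClayVariants.clayR3.Regularity`. Δ1 `ℝ³` = (for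
the claim; every estimate of §§2–6 is «on the D3Q13 lattice» / «in each cell» / «on the resolved
manifold»). **Δ2 equations: claim (1)–(2), `ν > 0`, unforced; proofs: lattice BGK with spectral cut-off,
recovering (1)–(2) «plus a remainder term R that is O(δ²)» (p.6 l.31–35), the limit `δ → 0` declared
«inconsistent» / «topologically forbidden» (p.6 l.29–30, p.7 l.1) — WRONG-PROBLEM HANDLE by construction
(RULINGS v1.35 (1)), recorded, not keyed by the typist.** Δ3 none = . Δ4 data `H^s ∩ C^∞`, `s ≥ 1/2`,
divergence-free — WIDER than Clay's class (4) (no decay of derivatives printed); the inclusion (4) ⊂ H^{1/2}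
is classical and is carried as the explicit hypothesis `ClayDelta` of the Clay link (pattern C04b). Δ5
conclusion «unique, global-in-time smooth solution»: no energy bound (7) in the claim sentence — the Clay
link takes the printed energy equality (Step 1) as the extra binder that supplies (7); uniqueness is
foreign to (A). Δ6 parameters foreign to (A): `δ, h, c, k_max, C, C(δ)`. Δ7 `ν > 0` arbitrary = .
`clay_of_claimed : ClaimedTheorem → Step1_EnergyEq → ClayDelta → clayR3.Regularity` PROVED.

## Step index (dependency order = argument order of `claim_of_steps`)

* Step L1 = `Step_L1_M2` — §2.2 p.3 l.12–27 (TRUE, `stepL1_holds`) · Step L2 = `Step_L2_M4iso` — p.3 l.28–40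
  (as printed; kernel-decidable; see the flag) — lattice grain, not consumed by the NS chain.
* Step 0 = `Step0_BKM` — (6) p.2 l.7–11 + the implicit local theory: BKM dichotomy from the data class.
* Step 1 = `Step1_EnergyEq` — §3.3 p.5 l.21–31: strict energy equality (consumed by the Clay link only).
* Step 2 = `Step2_Cell R` — §2.4 p.4 l.8–18 = §4.1 p.5 l.41–51: the cell inequality (support of Step 3).
* Step 3 = `Step3_EnstrophyLaw R` — §4.1 p.5 l.52–66: `dΩ/dt ≤ CΩ^{3/2} − Ω²/δ` — LOAD-BEARING.
* Step 4 = `Step4_Barrier R` — §4.2 p.5 l.67–74: `sup Ω ≤ max(Ω(0), C²δ/4)` from Step 3 (ODE comparison).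
* Step 5a = `Step5a_Cutoff R` — §4.3 p.5 l.85 «where ‖ω‖_{H²} ≤ k_max‖ω‖_{H¹}» (support of Step 5, the cut-off).
* Step 5 = `Step5_SupBound R` — §4.3 p.5 l.75–86: `‖ω(t)‖_∞ ≤ C(δ)√Ω(t)` — LOAD-BEARING.
* §6 p.6–7 (the bridge «recovered only as a regular solution on the resolved manifold … δ → 0 … forbidden»)
  is NOT typed: under the NS-grain typing of Steps 3–5 the chain composes without it (`claim_of_steps`);
  under the lattice reading it is the only connecting sentence and has no typable content (Δ2, CARD §3).
* §4.4 p.6 l.1–10 (bounded `‖ω‖_∞` ⇒ finite BKM integral on finite horizons) is bookkeeping, proved inline.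

WHAT THIS IS NOT: not a claim about NS regularity or blow-up; not a claim about any author beyond the typed
locator.
-/

open scoped ContDiff ENNReal NNReal Topology InnerProductSpace RealInnerProductSpace SchwartzMap
open _root_.MeasureTheory _root_.Set _root_.Filter

namespace Literature.Claims.NS.Guevremont2026

open Literature.Analysis.FluidPDE

noncomputable section

/-- `ℝ³` (plumbing abbreviation). [folklore] -/
abbrev E3 : Type := EuclideanSpace ℝ (Fin 3)

/-- `ℂ³`, carrier of the Fourier-side data class (plumbing abbreviation). [folklore] -/
abbrev C3 : Type := EuclideanSpace ℂ (Fin 3)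

/-! ## A. The D3Q13 lattice objects of §2 (p.3) — typed verbatim, in their own declarations -/

/-- The twelve face-diagonal lattice directions `e_a ∈ {(±1,±1,0), (±1,0,±1), (0,±1,±1)}`, `a = 1,…,12`
(§2.1 p.3 l.5–6); the rest vector `e₀ = 0` carries weight `w₀ = 0` (l.7) and drops out of every moment.
[cite: Guevremont2026, §2.1 p.3 l.2–8] -/
def dir : Fin 12 → Fin 3 → ℝ :=
  ![![1, 1, 0], ![1, -1, 0], ![-1, 1, 0], ![-1, -1, 0],
    ![1, 0, 1], ![1, 0, -1], ![-1, 0, 1], ![-1, 0, -1],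
    ![0, 1, 1], ![0, 1, -1], ![0, -1, 1], ![0, -1, -1]]

/-- The weights `w_a = 1/12`, `a = 1,…,12` (§2.1 p.3 l.7). [cite: Guevremont2026, §2.1 p.3 l.7] -/
def weight : ℝ := 1 / 12

/-- Kronecker delta on `Fin 3`. [folklore] -/
def kron (i j : Fin 3) : ℝ := if i = j then 1 else 0

/-- The second-order moment tensor `M_ij = Σ_{a=1}^{12} w_a e_{a,i} e_{a,j}` (§2.2 p.3 l.12–17).
[cite: Guevremont2026, §2.2 p.3 l.12–17] -/
def M2 (i j : Fin 3) : ℝ := ∑ a : Fin 12, weight * dir a i * dir a j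

/-- The fourth-order moment tensor `M_ijkl = Σ_{a=1}^{12} w_a e_{a,i} e_{a,j} e_{a,k} e_{a,l}` (§2.2 p.3
l.28–33). [cite: Guevremont2026, §2.2 p.3 l.28–33] -/
def M4 (i j k l : Fin 3) : ℝ := ∑ a : Fin 12, weight * dir a i * dir a j * dir a k * dir a l

/-- **Step L1 — §2.2 p.3 l.18–27**: «Explicit calculation over the twelve moving particles gives
Mxx = Myy = Mzz = 2/3, Mij = 0 for i ≠ j. Thus, Mij = (2/3)δij.» A finite computation; TRUE
(`stepL1_holds`). [claim: Guevremont2026, status: disputed] [cite: Guevremont2026, §2.2 p.3 l.18–27] -/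
def Step_L1_M2 : Prop :=
  ∀ i j : Fin 3, M2 i j = 2 / 3 * kron i j

/-- **Step L2 — §2.2 p.3 l.28–40**, the printed ground of the «Tension Tensor Lemma» §3.2 p.4 l.53–63
(«the residual term vanishes identically because of the symmetry of the face-diagonal velocity set»):
«Due to the symmetry of the face-diagonal set, this tensor takes the isotropic form
Mijkl = (1/3)(δijδkl + δikδjl + δilδjk). In particular, Mxxxx = 2/3 and Mxxyy = 1/3, satisfying the
required relations for fourth-order isotropy.» Typed AS PRINTED (the displayed identity, for all indices).
Typist's flag: kernel-decidable; the same sentence's values `Mxxxx = 2/3`, `Mxxyy = 1/3` are correct finite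
sums (`M4_xxxx`, `M4_xxyy` below) while the displayed isotropic form evaluates to `1` at `(x,x,x,x)` —
recorded, lattice grain, not consumed by the NS chain; the refuter decides whether it matters.
[claim: Guevremont2026, status: disputed] [cite: Guevremont2026, §2.2 p.3 l.28–40; §3.2 p.4 l.53–63] -/
def Step_L2_M4iso : Prop :=
  ∀ i j k l : Fin 3, M4 i j k l = 1 / 3 * (kron i j * kron k l + kron i k * kron j l + kron i l * kron j k)

/-- The undefined printed objects of §§2–4, carried as parameters (nothing about them is asserted here):
the «fixed temporal resolution parameter» `δ > 0` (§2.1 p.3 l.8, §2.3 l.47, p.5 l.66), the grid spacing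
`h` (p.3 l.2), the unspecified constant `C` of the enstrophy law (p.5 l.55), the constant `C(δ)` of §4.3
(p.5 l.82), and the cell functionals `‖ω‖²_cell`, `‖∇u‖_cell` of §2.4/§4.1 (never defined in the text),
as functions of a velocity slice and a cell label. [cite: Guevremont2026, §2.1–2.4 pp.3–4; §4.1–4.3 p.5] -/
structure Resolution where
  /-- `δ`, the «fixed temporal grain». -/
  δ : ℝ
  /-- `h`, the grid spacing. -/
  h : ℝ
  /-- `C` of «dΩ/dt ≤ CΩ^{3/2} − Ω²/δ» (p.5 l.55). -/
  C : ℝ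
  /-- `C(δ)` of «‖ω(t)‖_{L∞} ≤ C(δ)√Ω(t)» (p.5 l.82). -/
  Cδ : ℝ
  /-- `‖ω‖²_cell` (p.4 l.9–16, p.5 l.42–49): a functional of the velocity slice per cell. -/
  cellEns : (E3 → E3) → E3 → ℝ
  /-- `‖∇u‖_cell` (same displays). -/
  cellGrad : (E3 → E3) → E3 → ℝ
  /-- «δ > 0» (p.3 l.8). -/
  δ_pos : 0 < δ
  /-- `h > 0` (a grid spacing). -/
  h_pos : 0 < h

/-- The lattice speed `c = h/δ` (§2.1 p.3 l.7–8). [cite: Guevremont2026, §2.1 p.3 l.7–8] -/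
def Resolution.c (R : Resolution) : ℝ := R.h / R.δ

/-- The spectral cut-off `k_max = 1/(cδ)` (§2.3 p.3 l.47–50; `= 1/h`). [cite: Guevremont2026, §2.3 p.3 l.47–50] -/
def Resolution.kmax (R : Resolution) : ℝ := 1 / (R.c * R.δ)

/-- The right-hand side of the global enstrophy law of §4.1 p.5 l.54–61, `CΩ^{3/2} − (1/δ)Ω²`, with
`Ω^{3/2}` written `Ω·√Ω` (equal for `Ω ≥ 0`). [cite: Guevremont2026, §4.1 p.5 l.54–61] -/
def law (R : Resolution) (x : ℝ) : ℝ := R.C * (x * Real.sqrt x) - x ^ 2 / R.δ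

/-! ## B. The Navier–Stokes-grain objects -/

/-- `u₀ ∈ H^s(ℝ³)` (abstract p.1 l.8–10): the tempered distribution of `u₀` (tree predicate
`IsDistributionOf`, pairing `φ ↦ ∫ φ • u₀` on the complexified field) lies in the Sobolev space
`H^s = H^{s,2}(ℝ³)` of Mathlib (`TemperedDistribution.MemSobolev s 2`, Bessel-potential definition).
[cite: Guevremont2026, abstract p.1 l.8–10] -/
def InHs (s : ℝ) (u₀ : E3 → E3) : Prop :=
  ∃ U : 𝓢'(E3, C3), IsDistributionOf u₀ U ∧ TemperedDistribution.MemSobolev s 2 U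

/-- The printed data class: «any smooth, divergence-free initial velocity field u₀ ∈ H^s(R³)» (p.1 l.8–10),
at Sobolev index `s` (the claim takes `s ≥ 1/2`). [cite: Guevremont2026, abstract p.1 l.8–10] -/
def IsDatum (s : ℝ) (u₀ : E3 → E3) : Prop :=
  ContDiff ℝ ∞ u₀ ∧ VectorCalculus.IsDivFree u₀ ∧ InHs s u₀

/-- A «smooth solution» of (1)–(2) on `ℝ³ × [0,T)` from `u₀` (p.1 l.10–11, l.20–24): the tree's classical
solution (jointly `C^∞` velocity and pressure, momentum equation and incompressibility pointwise), unforced,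
viscosity `ν`, with `u(0) = u₀`. [cite: Guevremont2026, (1)–(2) p.1 l.20–25; abstract p.1 l.10–11] -/
structure IsSolution (ν T : ℝ) (u₀ : E3 → E3) (u : ℝ → E3 → E3) (p : ℝ → E3 → ℝ) : Prop where
  /-- (1)–(2) hold classically on `ℝ³ × [0,T)`, `u`, `p` jointly smooth. -/
  isClassical : IsClassicalNSSolutionOn (Ico 0 T) ν 0 u p
  /-- `u(·,0) = u₀`. -/
  initial : u 0 = u₀

/-- A «global-in-time smooth solution» (p.1 l.10–11): the same on `ℝ³ × [0,∞)`.
[cite: Guevremont2026, abstract p.1 l.10–11] -/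
structure IsGlobalSolution (ν : ℝ) (u₀ : E3 → E3) (u : ℝ → E3 → E3) (p : ℝ → E3 → ℝ) : Prop where
  /-- (1)–(2) hold classically on `ℝ³ × [0,∞)`, `u`, `p` jointly smooth. -/
  isClassical : IsClassicalNSSolutionOn (Ici 0) ν 0 u p
  /-- `u(·,0) = u₀`. -/
  initial : u 0 = u₀

/-- `∫|ω|²` of a velocity slice (`ω = ∇ × v`, (5) p.2 l.3), in `[0,∞]`; `Ω = ½·(this).toReal` where finite.
[cite: Guevremont2026, §4.1 p.5 l.62–66] -/
def ensE (v : E3 → E3) : ℝ≥0∞ := ∫⁻ x, ‖curl v x‖ₑ ^ 2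

/-- `Ω(t) = ½∫_{ℝ³}|ω|² dx` (p.5 l.62–66) as a real number along a velocity field `u` (`0` where the
integral diverges — the steps that display `Ω(t)` state its finiteness). [cite: Guevremont2026, §4.1 p.5 l.62–66] -/
def Omega (u : ℝ → E3 → E3) (t : ℝ) : ℝ := 1 / 2 * (ensE (u t)).toReal

/-- `‖ω(t)‖_{L∞}` of a velocity slice (p.2 l.11–13, p.5 l.78), in `[0,∞]` (same shape as the C102
skeleton's `Santak2026.vortSup`; re-declared to keep claim files independent).
[cite: Guevremont2026, (6) p.2 l.9–11; §4.3 p.5 l.78] -/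
def vortSup (v : E3 → E3) : ℝ≥0∞ := ⨆ x, ‖curl v x‖ₑ

/-! ## C. The claimed statement -/

/-- **CLAIMED THEOREM = the ABSTRACT p.1 l.7–15** (there is no theorem environment in the text; RULINGS
v1.35 (1)): «For any smooth, divergence-free initial velocity field u₀ ∈ H^s(R³) with s ≥ 1/2, there exists
a unique, global-in-time smooth solution u(x, t).» Typed: existence of a global smooth solution of (1)–(2)
on `ℝ³`, for every `ν > 0` (p.1 l.25), every `s ≥ 1/2` and every datum of the class. «Unique» is typed
separately (`ClaimedUniqueness`); the two method clauses («energy inequality is a strict equality»,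
«uniform L∞ bound [on the velocity gradient] for all t ≥ 0») are Steps 1 and 4–5.
[claim: Guevremont2026, status: disputed] [cite: Guevremont2026, abstract p.1 l.7–15] -/
def ClaimedTheorem : Prop :=
  ∀ ν : ℝ, 0 < ν → ∀ s : ℝ, 1 / 2 ≤ s → ∀ u₀ : E3 → E3, IsDatum s u₀ →
    ∃ (u : ℝ → E3 → E3) (p : ℝ → E3 → ℝ), IsGlobalSolution ν u₀ u p

/-- The word «unique» of p.1 l.11, AS PRINTED (uniqueness among global smooth solutions from the same
datum; the velocity is compared). Not consumed by the chain and not argued anywhere in the text. Typist's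
note (fact, no verdict): at this grain — no growth or energy condition on the solution — classical
non-uniqueness holds for (1)–(2) (from `u₀ = 0`: `u(t,x) = a(t)`, `p(t,x) = −a′(t)·x` for any smooth `a`
with `a(0) = 0`); within an energy class the statement would be weak–strong uniqueness. Recorded for the
referee's charity call. [claim: Guevremont2026, status: disputed] [cite: Guevremont2026, abstract p.1 l.11] -/
def ClaimedUniqueness : Prop :=
  ∀ ν : ℝ, 0 < ν → ∀ s : ℝ, 1 / 2 ≤ s → ∀ u₀ : E3 → E3, IsDatum s u₀ →
    ∀ (u u' : ℝ → E3 → E3) (p p' : ℝ → E3 → ℝ),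
      IsGlobalSolution ν u₀ u p → IsGlobalSolution ν u₀ u' p' → ∀ t : ℝ, 0 ≤ t → u t = u' t

/-! ## D. The steps -/

/-- **Step 0 — the Beale–Kato–Majda criterion (6) p.2 l.7–11** («a solution develops a singularity at time
T if and only if ∫₀ᵀ‖ω(·,t)‖_{L∞}dt = ∞») together with the local theory the text presupposes («the
solution remains smooth for all time», p.6 l.9): from every datum of the class, EITHER a global smooth
solution exists OR there are `T* > 0` and a smooth solution on `[0,T*)` whose BKM integral over `(0,T*)`
diverges. Typist's flag: classical for `H^∞` / Schwartz data (PROVED on that sub-class from the tree's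
BKM theorem, `step0_holds_onHInfty`); for the full printed class (`C^∞ ∩ H^s`, no decay of derivatives)
not a tree theorem — an implicit step, typed as used. [claim: Guevremont2026, status: disputed]
[cite: Guevremont2026, (6) p.2 l.7–11; §4.4 p.6 l.8–10] [cite: BealeKatoMajda1984, Thm. 1 and Corollary] -/
def Step0_BKM : Prop :=
  ∀ ν : ℝ, 0 < ν → ∀ s : ℝ, 1 / 2 ≤ s → ∀ u₀ : E3 → E3, IsDatum s u₀ →
    (∃ (u : ℝ → E3 → E3) (p : ℝ → E3 → ℝ), IsGlobalSolution ν u₀ u p) ∨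
    ∃ Ts : ℝ, 0 < Ts ∧ ∃ (u : ℝ → E3 → E3) (p : ℝ → E3 → ℝ),
      IsSolution ν Ts u₀ u p ∧ (∫⁻ t in Ioo 0 Ts, vortSup (u t)) = ⊤

/-- **Step 1 — the «strict energy equality» §3.3 p.5 l.21–31** («Integrating in time from 0 to t yields
the strict energy equality: ‖u(t)‖²_{L²} + 2ν∫₀ᵗ‖∇u(τ)‖²_{L²}dτ = ‖u(0)‖²_{L²}»), followed by l.32 «This
equality holds exactly on the resolved manifold, with no hidden energy sink». Typed along every smooth
solution of (1)–(2) on `[0,T)` from a datum of the class, in `[0,∞]` (lower Lebesgue integrals, `|∇u|²` the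
Frobenius square of `Du`). Consumed only by the Clay link (it supplies (7)). Typist's flag: TRUE-type for
classical solutions of an energy class with the decay that makes §3.3's integrations by parts licit (tree:
energy equality in Tao's class); at the printed grain (every smooth solution, no condition at `|x| → ∞`)
not a tree theorem; printed for «the recovered momentum equation» (l.2). [claim: Guevremont2026, status: disputed]
[cite: Guevremont2026, §3.3 p.5 l.1–34] -/
def Step1_EnergyEq : Prop :=
  ∀ ν : ℝ, 0 < ν → ∀ s : ℝ, 1 / 2 ≤ s → ∀ (T : ℝ) (u₀ : E3 → E3) (u : ℝ → E3 → E3) (p : ℝ → E3 → ℝ),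
    IsDatum s u₀ → IsSolution ν T u₀ u p → ∀ t ∈ Ico 0 T,
      (∫⁻ x, ‖u t x‖ₑ ^ 2) +
          ENNReal.ofReal (2 * ν) * ∫⁻ τ in Ioo 0 t, ∫⁻ x, ENNReal.ofReal (frobeniusNormSq (fderiv ℝ (u τ) x)) =
        ∫⁻ x, ‖u₀ x‖ₑ ^ 2

/-- **Step 2 — the cell enstrophy inequality §2.4 p.4 l.8–18 = §4.1 p.5 l.41–51** («On the D3Q13 lattice
the local enstrophy in each cell satisfies d/dt‖ω‖²_cell ≤ 2‖ω‖²_cell‖∇u‖_cell − ‖ω‖⁴_cell/δ. The quartic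
term comes directly from the 13-node pivot redistribution.»), typed over the undefined cell functionals of
`R`, along every solution from a datum of the class, at interior times, for every cell label. The printed
SUPPORT of Step 3 («Integrating over space gives», l.52–53); with `cellEns`, `cellGrad` free it is not
falsifiable on its own. [claim: Guevremont2026, status: disputed]
[cite: Guevremont2026, §2.4 p.4 l.5–20; §4.1 p.5 l.40–52] -/
def Step2_Cell (R : Resolution) : Prop :=
  ∀ ν : ℝ, 0 < ν → ∀ s : ℝ, 1 / 2 ≤ s → ∀ (T : ℝ) (u₀ : E3 → E3) (u : ℝ → E3 → E3) (p : ℝ → E3 → ℝ),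
    IsDatum s u₀ → IsSolution ν T u₀ u p → ∀ t ∈ Ioo 0 T, ∀ x : E3,
      DifferentiableAt ℝ (fun τ => R.cellEns (u τ) x) t ∧
        deriv (fun τ => R.cellEns (u τ) x) t ≤
          2 * R.cellEns (u t) x * R.cellGrad (u t) x - R.cellEns (u t) x ^ 2 / R.δ

/-- **Step 3 — the global enstrophy law §4.1 p.5 l.52–66, LOAD-BEARING**: «Integrating over space gives the
global enstrophy inequality dΩ/dt ≤ CΩ^{3/2} − (1/δ)Ω², where Ω(t) = ½∫_{R³}|ω|² dx and δ > 0 is any fixed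
positive resolution parameter.» Typed along every smooth solution of (1)–(2) on `[0,T)` from a datum of the
class: `Ω(t)` is finite on `[0,T)` (implicit in displaying it as a number and in §4.2's `Ω(0)`), continuous
on `[0,T)`, differentiable on `(0,T)`, and obeys the law there with the constants `C`, `δ` of `R`.
Typist's flag: suspicious — an a-priori law for (1)–(2) with an absorbing term `−Ω²/δ` and solution-
independent constants (scale-covariance under (3) p.1 l.33–37 forces none; cf. tree barrier
`Literature.Barriers.NavierStokesRegularity.VortexStretchingAprioriBounds`); printed «on the D3Q13
lattice». [claim: Guevremont2026, status: disputed] [cite: Guevremont2026, §4.1 p.5 l.52–66] -/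
def Step3_EnstrophyLaw (R : Resolution) : Prop :=
  ∀ ν : ℝ, 0 < ν → ∀ s : ℝ, 1 / 2 ≤ s → ∀ (T : ℝ) (u₀ : E3 → E3) (u : ℝ → E3 → E3) (p : ℝ → E3 → ℝ),
    IsDatum s u₀ → IsSolution ν T u₀ u p →
      (∀ t ∈ Ico 0 T, ensE (u t) < ⊤) ∧ ContinuousOn (Omega u) (Ico 0 T) ∧
        ∀ t ∈ Ioo 0 T, DifferentiableAt ℝ (Omega u) t ∧ deriv (Omega u) t ≤ law R (Omega u t)

/-- **Step 4 — §4.2 p.5 l.67–74** («The negative quadratic term dominates for large Ω. Standard ODE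
comparison shows sup_{t≥0} Ω(t) ≤ max(Ω(0), C²δ/4). The bound is time-independent.»), typed at the function
grain: every non-negative `Y`, continuous on `[0,T)`, differentiable on `(0,T)` with `Y′ ≤ CY^{3/2} − Y²/δ`
there, stays below `max(Y(0), C²δ/4)` on `[0,T)`. Typist's flag (arithmetic on the page, LOCATORS §4): the
right-hand side changes sign at `Y = C²δ²`, not at the printed level `C²δ/4`; the barrier statement is
true-type when `max(Y(0), C²δ/4) ≥ C²δ²` is automatic (e.g. `δ ≤ 1/4` or `C ≤ 0`) and fails at the function
grain for `C > 0`, `δ > 1/4` (start between the two levels) — recorded as printed; the charitable level is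
the referee's call. [claim: Guevremont2026, status: disputed] [cite: Guevremont2026, §4.2 p.5 l.67–74] -/
def Step4_Barrier (R : Resolution) : Prop :=
  ∀ (Y : ℝ → ℝ) (T : ℝ), ContinuousOn Y (Ico 0 T) → (∀ t ∈ Ico 0 T, 0 ≤ Y t) →
    (∀ t ∈ Ioo 0 T, DifferentiableAt ℝ Y t ∧ deriv Y t ≤ law R (Y t)) →
      ∀ t ∈ Ico 0 T, Y t ≤ max (Y 0) (R.C ^ 2 * R.δ / 4)

/-- **Step 5a — the cut-off clause of §4.3 p.5 l.85** («where ‖ω‖_{H²} ≤ kmax‖ω‖_{H¹}», with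
`kmax = 1/(cδ)` of §2.3 p.3 l.47–50: the spectral projection `P` of the lattice), typed along every smooth
solution of (1)–(2) on `[0,T)` from a datum of the class, with the tree's Fourier-side homogeneous Sobolev
seminorms of the (complexified) vorticity slice. The printed SUPPORT of Step 5 together with Agmon's
inequality; not consumed by the composition (Step 5 is consumed end-to-end). Typist's flag: a band-limit
(Bernstein-type) property of lattice-projected fields, asserted here for solutions of (1)–(2) — the Δ2
object at the NS grain; suspicious. [claim: Guevremont2026, status: disputed]
[cite: Guevremont2026, §4.3 p.5 l.77–85; §2.3 p.3 l.46–54] -/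
def Step5a_Cutoff (R : Resolution) : Prop :=
  ∀ ν : ℝ, 0 < ν → ∀ s : ℝ, 1 / 2 ≤ s → ∀ (T : ℝ) (u₀ : E3 → E3) (u : ℝ → E3 → E3) (p : ℝ → E3 → ℝ),
    IsDatum s u₀ → IsSolution ν T u₀ u p → ∀ t ∈ Ico 0 T,
      Function.eHomSobolevSeminorm 2
          (Literature.Analysis.FunctionSpaces.EuclideanSpace.complexify ∘ curl (u t)) ≤
        ENNReal.ofReal R.kmax *
          Function.eHomSobolevSeminorm 1
            (Literature.Analysis.FunctionSpaces.EuclideanSpace.complexify ∘ curl (u t))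

/-- **Step 5 — §4.3 p.5 l.75–86, LOAD-BEARING** («By the Agmon inequality in 3D and the spectral cutoff
kmax = 1/(cδ), ‖ω(t)‖_{L∞} ≤ C‖ω‖^{1/2}_{H¹}‖ω‖^{1/2}_{H²} ≤ C(δ)√Ω(t), where ‖ω‖_{H²} ≤ kmax‖ω‖_{H¹}. Since
Ω(t) is uniformly bounded, ‖∇u(t)‖_{L∞} is also uniformly bounded for all t ≥ 0.»): typed as the end-to-end
bound the chain consumes, along every smooth solution of (1)–(2) on `[0,T)` from a datum of the class:
`‖ω(t)‖_∞ ≤ C(δ)√Ω(t)` in `[0,∞]`. Its printed support — Agmon plus the cut-off inequality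
`‖ω‖_{H²} ≤ k_max‖ω‖_{H¹}` of band-limited (lattice-projected) fields — is not typed separately. Typist's
flag: suspicious (an a-priori sup-by-`L²` law for (1)–(2); under (3) the two sides scale as `λ²` and
`λ^{1/2}`); printed with the lattice cut-off. [claim: Guevremont2026, status: disputed]
[cite: Guevremont2026, §4.3 p.5 l.75–86] -/
def Step5_SupBound (R : Resolution) : Prop :=
  ∀ ν : ℝ, 0 < ν → ∀ s : ℝ, 1 / 2 ≤ s → ∀ (T : ℝ) (u₀ : E3 → E3) (u : ℝ → E3 → E3) (p : ℝ → E3 → ℝ),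
    IsDatum s u₀ → IsSolution ν T u₀ u p → ∀ t ∈ Ico 0 T,
      vortSup (u t) ≤ ENNReal.ofReal (R.Cδ * Real.sqrt (Omega u t))

/-- **The Clay delta Δ4 as an explicit hypothesis** (pattern C04b): Fefferman's data class (4) — smooth,
divergence-free, rapidly decaying with all derivatives — lies inside the printed class at `s = 1/2`
(indeed at every `s`: such fields are Schwartz, and `𝒮 ⊂ H^s`), and has finite energy. Classical; the tree
has the Schwartz ⇒ `H^s` inclusion only for bundled Schwartz maps (`inHs_of_hasCompactSupport` below covers
`C_c^∞`), so the inclusion for (4) is carried as a hypothesis of the Clay link, not asserted.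
[cite: FeffermanClay2006, (4) p.1] [cite: BahouriCheminDanchin2011, §1.4.1] -/
def ClayDelta : Prop :=
  ∀ u₀ : E3 → E3, ContDiff ℝ ∞ u₀ → VectorCalculus.IsDivFree u₀ → HasRapidSpatialDecay u₀ →
    IsDatum (1 / 2) u₀ ∧ (∫⁻ x, ‖u₀ x‖ₑ ^ 2) < ⊤

/-! ## E. Kernel facts about the typed objects -/

/-- **Step L1 holds**: `M_ij = (2/3)δ_ij` by direct computation over the twelve directions.
[cite: Guevremont2026, §2.2 p.3 l.18–27] -/
theorem stepL1_holds : Step_L1_M2 := by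
  intro i j
  fin_cases i <;> fin_cases j <;> simp [M2, dir, kron, weight, Fin.sum_univ_succ] <;> norm_num

/-- `M_xxxx = 2/3` (p.3 l.39), by direct computation. [cite: Guevremont2026, §2.2 p.3 l.39] -/
theorem M4_xxxx : M4 0 0 0 0 = 2 / 3 := by
  simp [M4, dir, weight, Fin.sum_univ_succ]; norm_num

/-- `M_xxyy = 1/3` (p.3 l.39), by direct computation. [cite: Guevremont2026, §2.2 p.3 l.39] -/
theorem M4_xxyy : M4 0 0 1 1 = 1 / 3 := by
  simp [M4, dir, weight, Fin.sum_univ_succ]; norm_num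

/-- The displayed isotropic form of Step L2 evaluates to `1` at `(x,x,x,x)` (arithmetic; recorded next to
`M4_xxxx = 2/3` — no verdict drawn here). [cite: Guevremont2026, §2.2 p.3 l.34–40] -/
theorem isoForm_xxxx : (1 / 3 : ℝ) * (kron 0 0 * kron 0 0 + kron 0 0 * kron 0 0 + kron 0 0 * kron 0 0) = 1 := by
  simp [kron]; norm_num

/-- **A sufficient condition for the printed data class**: every smooth compactly supported field lies in
`H^s(ℝ³)` for every `s` — its tempered distribution is that of the Schwartz map `complexify ∘ u₀`, and
Schwartz maps lie in every Sobolev space (Mathlib `SchwartzMap.memSobolev`). [folklore]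
[cite: BahouriCheminDanchin2011, §1.4.1] -/
theorem inHs_of_hasCompactSupport {u₀ : E3 → E3} (hs : ContDiff ℝ ∞ u₀) (hc : HasCompactSupport u₀)
    (s : ℝ) : InHs s u₀ := by
  have hgs : ContDiff ℝ ∞ (Literature.Analysis.FunctionSpaces.EuclideanSpace.complexify ∘ u₀) :=
    Literature.Analysis.FunctionSpaces.EuclideanSpace.contDiff_complexify_comp_iff.2 hs
  have hgc : HasCompactSupport (Literature.Analysis.FunctionSpaces.EuclideanSpace.complexify ∘ u₀) :=
    hc.comp_left (map_zero Literature.Analysis.FunctionSpaces.EuclideanSpace.complexify)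
  refine ⟨((hgc.toSchwartzMap hgs : 𝓢(E3, C3)) : 𝓢'(E3, C3)), fun φ => ⟨?_, ?_⟩,
    (hgc.toSchwartzMap hgs).memSobolev⟩
  · have hφg : HasCompactSupport
        ((φ : E3 → ℂ) • (Literature.Analysis.FunctionSpaces.EuclideanSpace.complexify ∘ u₀)) :=
      hgc.smul_left
    exact (φ.continuous.smul hgs.continuous).integrable_of_hasCompactSupport hφg
  · rw [SchwartzMap.coe_apply]
    rfl

/-- A compactly supported smooth divergence-free field is a datum of the printed class «smooth,
divergence-free … u₀ ∈ H^s(R³)» at every index `s` (from `inHs_of_hasCompactSupport`).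
[cite: Guevremont2026, abstract p.1 l.8–10] [cite: BahouriCheminDanchin2011, §1.4.1] -/
theorem isDatum_of_hasCompactSupport {u₀ : E3 → E3} (hs : ContDiff ℝ ∞ u₀) (hdiv : VectorCalculus.IsDivFree u₀)
    (hc : HasCompactSupport u₀) (s : ℝ) : IsDatum s u₀ :=
  ⟨hs, hdiv, inHs_of_hasCompactSupport hs hc s⟩

/-- **Step 0 on the tree's `H^∞` sub-class**: for data with every derivative in `L²` (the cell's BKM-class
datum `Chae2007.IsDatum`) that also lie in the printed class, the dichotomy of Step 0 holds — the tree's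
`exists_global_bkmClass_or_blowup` (Beale–Kato–Majda 1984 / Majda–Bertozzi 2002 Thm 3.6), whose
solutions are smooth solutions in the sense typed here. [cite: BealeKatoMajda1984, Thm. 1 and Corollary]
[cite: MajdaBertozzi2002, Thm. 3.6 and §3.3 (pp. 115–117)] -/
theorem step0_holds_onHInfty {ν : ℝ} (hν : 0 < ν) {u₀ : E3 → E3} (hu₀ : Chae2007.IsDatum u₀) :
    (∃ (u : ℝ → E3 → E3) (p : ℝ → E3 → ℝ), IsGlobalSolution ν u₀ u p) ∨
    ∃ Ts : ℝ, 0 < Ts ∧ ∃ (u : ℝ → E3 → E3) (p : ℝ → E3 → ℝ),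
      IsSolution ν Ts u₀ u p ∧ (∫⁻ t in Ioo 0 Ts, vortSup (u t)) = ⊤ := by
  obtain ⟨hsm, hdiv, hH⟩ := hu₀
  rcases exists_global_bkmClass_or_blowup hν.le hsm hdiv hH with
    ⟨u, p, hu, hu0, -, -⟩ | ⟨T, hT, u, p, hu, hu0, -, -, -, hint, -⟩
  · exact Or.inl ⟨u, p, ⟨hu, hu0⟩⟩
  · exact Or.inr ⟨T, hT, u, p, ⟨hu, hu0⟩, hint⟩

/-! ## F. Bookkeeping -/

/-- A global smooth solution restricts to a smooth solution on every `[0,T)`. [folklore] -/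
private theorem IsGlobalSolution.restrict {ν : ℝ} (T : ℝ) {u₀ : E3 → E3} {u : ℝ → E3 → E3} {p : ℝ → E3 → ℝ}
    (h : IsGlobalSolution ν u₀ u p) : IsSolution ν T u₀ u p :=
  ⟨h.isClassical.mono Ico_subset_Ici_self (uniqueDiffOn_Ico 0 T), h.initial⟩

/-- `Ω(t) ≥ 0`. [folklore] -/
private theorem Omega_nonneg (u : ℝ → E3 → E3) (t : ℝ) : 0 ≤ Omega u t := by
  unfold Omega; positivity

/-! ## G. Kernel composition -/

/-- Along a smooth solution on `[0,T)`, Steps 3–5 bound `‖ω(t)‖_∞` uniformly on `[0,T)`: Step 3 feeds Step 4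
with `Y = Ω`, and Step 5 converts the enstrophy bound into a sup bound.
[cite: Guevremont2026, §4.1–4.3 p.5 l.40–86] -/
theorem vortSup_le_of_steps (R : Resolution) (h3 : Step3_EnstrophyLaw R) (h4 : Step4_Barrier R)
    (h5 : Step5_SupBound R) {ν : ℝ} (hν : 0 < ν) {s : ℝ} (hs : 1 / 2 ≤ s) {T : ℝ} {u₀ : E3 → E3}
    {u : ℝ → E3 → E3} {p : ℝ → E3 → ℝ} (hd : IsDatum s u₀) (hS : IsSolution ν T u₀ u p) :
    ∀ t ∈ Ico 0 T, vortSup (u t) ≤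
      ENNReal.ofReal (|R.Cδ| * Real.sqrt (max (Omega u 0) (R.C ^ 2 * R.δ / 4))) := by
  obtain ⟨-, hcont, hdiff⟩ := h3 ν hν s hs T u₀ u p hd hS
  intro t ht
  have hΩ : Omega u t ≤ max (Omega u 0) (R.C ^ 2 * R.δ / 4) :=
    h4 (Omega u) T hcont (fun τ _ => Omega_nonneg u τ) hdiff t ht
  refine (h5 ν hν s hs T u₀ u p hd hS t ht).trans (ENNReal.ofReal_le_ofReal ?_)
  calc R.Cδ * Real.sqrt (Omega u t) ≤ |R.Cδ| * Real.sqrt (Omega u t) :=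
        mul_le_mul_of_nonneg_right (le_abs_self _) (Real.sqrt_nonneg _)
    _ ≤ |R.Cδ| * Real.sqrt (max (Omega u 0) (R.C ^ 2 * R.δ / 4)) :=
        mul_le_mul_of_nonneg_left (Real.sqrt_le_sqrt hΩ) (abs_nonneg _)

/-- **COMPOSITION** — Steps 0, 3, 4, 5 (with Step 2 the printed support of Step 3 and Step 1 the energy
clause used only by the Clay link) imply the claimed statement, for any choice of the printed objects `R`:
Step 0 splits; in the blow-up branch Steps 3–5 bound `‖ω‖_∞` on `[0,T*)`, so the BKM integral over the
finite horizon is finite (§4.4 p.6 l.1–10, «grows at most linearly in T») — contradiction.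
[cite: Guevremont2026, §§1–4 pp.1–6; §8 p.8 l.2–7] -/
theorem claim_of_steps (R : Resolution) (h0 : Step0_BKM) (_h1 : Step1_EnergyEq) (_h2 : Step2_Cell R)
    (h3 : Step3_EnstrophyLaw R) (h4 : Step4_Barrier R) (_h5a : Step5a_Cutoff R) (h5 : Step5_SupBound R) :
    ClaimedTheorem := by
  intro ν hν s hs u₀ hd
  rcases h0 ν hν s hs u₀ hd with hG | ⟨Ts, _hTs, u, p, hL, hint⟩
  · exact hG
  · exfalso
    set B : ℝ := |R.Cδ| * Real.sqrt (max (Omega u 0) (R.C ^ 2 * R.δ / 4))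
    have hle : (∫⁻ t in Ioo 0 Ts, vortSup (u t)) ≤ ∫⁻ _t in Ioo 0 Ts, ENNReal.ofReal B :=
      setLIntegral_mono' measurableSet_Ioo fun t ht =>
        vortSup_le_of_steps R h3 h4 h5 hν hs hd hL t (Ioo_subset_Ico_self ht)
    have hlt : (∫⁻ t in Ioo 0 Ts, vortSup (u t)) < ⊤ := by
      refine lt_of_le_of_lt hle ?_
      rw [setLIntegral_const]
      exact ENNReal.mul_lt_top ENNReal.ofReal_lt_top measure_Ioo_lt_top
    exact absurd hint hlt.ne

/-! ## H. The Clay link -/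

/-- **Clay link** — the claimed statement (existence for the WIDER printed class), the printed energy
equality (Step 1, supplying Fefferman's (7)) and the data inclusion `ClayDelta` (Δ4) give Clay (A)
(`ClayVariants.clayR3.Regularity`): the global smooth solution is Clay-admissible because its energy at every
`t ≥ 0` is at most `‖u₀‖²_{L²} < ∞`. [cite: FeffermanClay2006, (A) with (1)–(4), (6), (7) pp.1–2]
[cite: Guevremont2026, abstract p.1 l.7–15; §3.3 p.5 l.21–31] -/
theorem clay_of_claimed (h : ClaimedTheorem) (h1 : Step1_EnergyEq) (hΔ : ClayDelta) :
    ClayVariants.clayR3.Regularity := by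
  intro ν hν u₀ hsm hdiv hdec
  obtain ⟨hd, hE0⟩ := hΔ u₀ hsm hdiv hdec
  obtain ⟨u, p, hG⟩ := h ν hν (1 / 2) le_rfl u₀ hd
  obtain ⟨hns, hsu, hsp⟩ :=
    (isNavierStokesSolution_and_smooth_iff (ν := ν) (f := 0) (u₀ := u₀) (u := u) (p := p)).2
      ⟨hG.isClassical, hG.initial⟩
  refine ⟨u, p, hsu, hsp, hns, ?_⟩
  show HasBoundedEnergy u
  refine ⟨∫⁻ x, ‖u₀ x‖ₑ ^ 2, hE0, fun t ht => ?_⟩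
  have key := h1 ν hν (1 / 2) le_rfl (t + 1) u₀ u p hd (hG.restrict (t + 1)) t ⟨ht, by linarith⟩
  calc (∫⁻ x, ‖u t x‖ₑ ^ 2)
      ≤ (∫⁻ x, ‖u t x‖ₑ ^ 2) +
          ENNReal.ofReal (2 * ν) *
            ∫⁻ τ in Ioo 0 t, ∫⁻ x, ENNReal.ofReal (frobeniusNormSq (fderiv ℝ (u τ) x)) := le_self_add
    _ = ∫⁻ x, ‖u₀ x‖ₑ ^ 2 := key

/-! ## I. The Clay delta discharged (keeper ns-claims-lit-4; CLAY-LINK #131) -/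

/-- The complexified field `complexify ∘ u₀` of a smooth field of Fefferman's class (4) as a Mathlib Schwartz
map: (4) is exactly Schwartz decay of every derivative (`‖x‖^k ≤ (1+‖x‖)^k`), and the complexification is a
real linear isometry, so the derivative norms agree. Same device as the tree's `FourierNS.schwartzData`
(componentwise). [folklore] [cite: FeffermanClay2006, (4) p.1] -/
def schwartzOfRapidDecay {u₀ : E3 → E3} (hs : ContDiff ℝ ∞ u₀) (hdec : HasRapidSpatialDecay u₀) :
    𝓢(E3, C3) where
  toFun := Literature.Analysis.FunctionSpaces.EuclideanSpace.complexify ∘ u₀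
  smooth' := Literature.Analysis.FunctionSpaces.EuclideanSpace.contDiff_complexify_comp_iff.2 hs
  decay' k n := by
    obtain ⟨C, hC⟩ := hdec n k
    refine ⟨C, fun x => ?_⟩
    rw [LinearIsometry.norm_iteratedFDeriv_comp_left _ hs.contDiffAt (mod_cast le_top)]
    calc ‖x‖ ^ k * ‖iteratedFDeriv ℝ n u₀ x‖ ≤ (1 + ‖x‖) ^ k * ‖iteratedFDeriv ℝ n u₀ x‖ := by
          gcongr; linarith [norm_nonneg x]
      _ ≤ C := hC x

/-- Values of `schwartzOfRapidDecay` (plumbing). [folklore] -/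
@[simp] private theorem schwartzOfRapidDecay_apply {u₀ : E3 → E3} (hs : ContDiff ℝ ∞ u₀)
    (hdec : HasRapidSpatialDecay u₀) (x : E3) :
    schwartzOfRapidDecay hs hdec x = Literature.Analysis.FunctionSpaces.EuclideanSpace.complexify (u₀ x) :=
  rfl

/-- **Schwartz ⊂ H^s**: a smooth field of class (4) lies in the printed data space `H^s(ℝ³)` for EVERY `s` —
its tempered distribution is that of the Schwartz map `complexify ∘ u₀`, and Schwartz maps lie in every
Sobolev space (Mathlib `SchwartzMap.memSobolev`). [folklore] [cite: BahouriCheminDanchin2011, §1.4.1] -/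
theorem inHs_of_hasRapidSpatialDecay {u₀ : E3 → E3} (hs : ContDiff ℝ ∞ u₀) (hdec : HasRapidSpatialDecay u₀)
    (s : ℝ) : InHs s u₀ := by
  set g : 𝓢(E3, C3) := schwartzOfRapidDecay hs hdec with hg
  refine ⟨(g : 𝓢'(E3, C3)), fun φ => ⟨?_, ?_⟩, g.memSobolev⟩
  · have h1 : Integrable (fun x => φ x) (volume : Measure E3) := φ.integrable
    have h2 : MemLp (fun x => g x) ∞ (volume : Measure E3) := g.memLp ⊤
    have h3 := h1.smul_of_top_left h2
    exact h3
  · rw [SchwartzMap.coe_apply]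
    rfl

/-- **The Clay delta `ClayDelta` HOLDS** (CLAY-LINK #131): every smooth divergence-free field of Fefferman's
class (4) is a printed datum at `s = 1/2` (indeed at every `s`) and has finite energy (`Dⁿu₀ ∈ L²` for all
`n` by the decay, tree `HasRapidSpatialDecay.lintegral_enorm_iteratedFDeriv_sq_lt_top`, at `n = 0`).
[folklore] [cite: FeffermanClay2006, (4) p.1] [cite: BahouriCheminDanchin2011, §1.4.1] -/
theorem clayDelta_holds : ClayDelta := by
  intro u₀ hs hdiv hdec
  refine ⟨⟨hs, hdiv, inHs_of_hasRapidSpatialDecay hs hdec _⟩, ?_⟩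
  have h0 := hdec.lintegral_enorm_iteratedFDeriv_sq_lt_top (μ := (volume : Measure E3)) 0
  have heq : (fun x => ‖iteratedFDeriv ℝ 0 u₀ x‖ₑ ^ 2) = fun x => ‖u₀ x‖ₑ ^ 2 := by
    funext x
    rw [← ofReal_norm, ← ofReal_norm, norm_iteratedFDeriv_zero]
  rw [heq] at h0
  exact h0

/-- **Clay link with the Δ4 binder discharged**: the claimed statement (existence for the WIDER printed
class) and the printed energy equality (Step 1, supplying Fefferman's (7)) give Clay (A). The remaining
extra binder `Step1_EnergyEq` is the paper's own §3.3 step (not a Clay-axis delta).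
[cite: FeffermanClay2006, (A) with (1)–(4), (6), (7) pp.1–2] [cite: Guevremont2026, abstract p.1 l.7–15; §3.3 p.5 l.21–31] -/
theorem clay_of_claimed' (h : ClaimedTheorem) (h1 : Step1_EnergyEq) : ClayVariants.clayR3.Regularity :=
  clay_of_claimed h h1 clayDelta_holds

end

end Literature.Claims.NS.Guevremont2026

-- WHAT THIS IS NOT: not a claim about NS regularity or blow-up; not a claim about any author beyond
-- the typed locator.
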